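import Mathlib.Combinatorics.Enumerative.Partition.Basic
import Mathlib.Algebra.BigOperators.Ring.Finset
import Mathlib.Algebra.Order.BigOperators.Group.Finset
import Mathlib.Algebra.BigOperators.NatAntidiagonal
import Mathlib.RingTheory.PowerSeries.Derivative
import Mathlib.Topology.Algebra.InfiniteSum.Real
import Mathlib.Topology.Algebra.Order.LiminfLimsup
import Mathlib.Tactic

/-!
# The cycle-index recursion of the free Bose gas: structure of the canonical partition function

Support file for the discharge of the barrier fact
`Literature.Barriers.AtomisticToContinuum.FeynmanCyclesVersusCondensation`
(`FeynmanCyclesVersusCondensationProofs.lean`).  Everything here is elementary combinatorics of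
the sequence `Z_N` defined, for cycle weights `a : ℕ → ℝ` (`a_j = tr e^{-jβh}` for free bosons),
by the cycle-index sum over cycle types = partitions of `N`,
`Z_N = ∑_{p ⊢ N} ∏_j (a_j/j)^{m_j}/m_j!`
(this is literally `canonicalZ` of the catalogue file, [Suto2002, §2.1 (7)]), and of any
sequence `Z` solving the equivalent **recursion**
`Z_0 = 1`, `N Z_N = ∑_{j=1}^{N} a_j Z_{N-j}`
(the content of `∑_j P_{Λ,N}(ξ₁ = j) = 1` with [Suto2002, §1 (4), §2.1 (10)]).  No new
definitions are introduced: the recursion is carried as the explicit pair of hypotheses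
`Z 0 = 1`, `∀ n, n * Z n = ∑ j ∈ Icc 1 n, a j * Z (n - j)`.

* `partitionSum_rec`: the cycle-index sum solves the recursion (bijection "remove one cycle of
  length `j`", Mathlib's `Nat.Partition.partitionWithPartEquiv`); `exists_cycleSol`.
* `cycleSol_unique`, `cycleSol_geom` (`a_j = c^j ⇒ Z_n = c^n`), `cycleSol_conv` (the exponential
  formula `Z^{a+b} = Z^a * Z^b`, via `X·d/dX` being a derivation on `ℝ⟦X⟧`),
  `cycleSol_nonneg/pos`, `cycleSol_monotone` (one extra mode of weight `1` makes `Z` the partial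
  sums of a nonnegative sequence).
* `logConcave_of_conv_geom`: log-concavity survives convolution with a geometric sequence;
  hence `cycleSol_logConcave_finset`: for finite positive power sums `a_j = ∑_{i∈S} x_i^j` the
  solution (a complete homogeneous symmetric polynomial of the `x_i`) is log-concave,
  `Z_N Z_{N+2} ≤ Z_{N+1}²`; `tendsto_cycleSol`, `cycleSol_logConcave_of_tendsto` pass this to
  limits of the weights.

## References

* [Suto2002] A. Sütő, *Percolation transition in the Bose gas: II*, J. Phys. A 35 (2002)
  6995–7002: §1 (4)–(5), §2.1 (7), (10).
-/

noncomputable section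

open Finset Filter
open scoped BigOperators Topology

namespace Literature.Barriers.AtomisticToContinuum.BoseGas.IdealGas

/-! ### The cycle-index sum solves the recursion -/

/-- Adding one cycle of length `j` to a cycle type `s` multiplies the cycle weight
`∏_i (a_i/i)^{m_i}/m_i!` by `a_j / (j (m_j + 1))`. [folklore] -/
theorem cycleWeight_cons (a : ℕ → ℝ) (s : Multiset ℕ) {j : ℕ} (hj : j ≠ 0) :
    (∏ i ∈ (j ::ₘ s).toFinset,
        (a i / i) ^ (j ::ₘ s).count i / ((j ::ₘ s).count i).factorial) *
        ((s.count j + 1 : ℕ) * j : ℝ) =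
      a j * ∏ i ∈ s.toFinset, (a i / i) ^ s.count i / (s.count i).factorial := by
  classical
  set f : Multiset ℕ → ℕ → ℝ := fun t i => (a i / i) ^ t.count i / (t.count i).factorial with hf
  have hT : (j ::ₘ s).toFinset = insert j s.toFinset := Multiset.toFinset_cons j s
  have hs : ∏ i ∈ s.toFinset, f s i = ∏ i ∈ insert j s.toFinset, f s i := by
    rw [Finset.prod_insert_of_eq_one_if_notMem]
    intro h
    have : s.count j = 0 := Multiset.count_eq_zero.mpr (by simpa using h)
    simp [hf, this]
  change (∏ i ∈ (j ::ₘ s).toFinset, f (j ::ₘ s) i) * _ = a j * ∏ i ∈ s.toFinset, f s i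
  rw [hs, hT, ← Finset.mul_prod_erase _ _ (Finset.mem_insert_self j _),
    ← Finset.mul_prod_erase _ (f s) (Finset.mem_insert_self j _)]
  have hrest : ∏ i ∈ (insert j s.toFinset).erase j, f (j ::ₘ s) i =
      ∏ i ∈ (insert j s.toFinset).erase j, f s i := by
    refine Finset.prod_congr rfl fun i hi => ?_
    have hij : i ≠ j := Finset.ne_of_mem_erase hi
    simp [hf, Multiset.count_cons_of_ne hij]
  rw [hrest]
  have hfj : f (j ::ₘ s) j * ((s.count j + 1 : ℕ) * j : ℝ) = a j * f s j := by
    simp only [hf, Multiset.count_cons_self, Nat.factorial_succ, pow_succ, div_pow]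
    have hj' : (j : ℝ) ≠ 0 := by exact_mod_cast hj
    have hm : ((s.count j).factorial : ℝ) ≠ 0 := by positivity
    have hjm : ((j : ℝ)) ^ s.count j ≠ 0 := pow_ne_zero _ hj'
    push_cast
    field_simp
  calc (f (j ::ₘ s) j * ∏ i ∈ (insert j s.toFinset).erase j, f s i) *
        ((s.count j + 1 : ℕ) * j : ℝ)
      = (f (j ::ₘ s) j * ((s.count j + 1 : ℕ) * j : ℝ)) *
          ∏ i ∈ (insert j s.toFinset).erase j, f s i := by ring
    _ = a j * (f s j * ∏ i ∈ (insert j s.toFinset).erase j, f s i) := by rw [hfj]; ring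

/-- For a partition `p` of `N`: `N = ∑_{j=1}^{N} j · m_j(p)`. [folklore] -/
theorem natCast_eq_sum_count_mul (N : ℕ) (p : Nat.Partition N) :
    (N : ℝ) = ∑ j ∈ Finset.Icc 1 N, ((p.parts.count j : ℕ) * j : ℝ) := by
  classical
  have hsub : p.parts.toFinset ⊆ Finset.Icc 1 N := by
    intro i hi
    rw [Multiset.mem_toFinset] at hi
    exact Finset.mem_Icc.mpr ⟨p.parts_pos hi, Nat.Partition.le_of_mem_parts hi⟩
  have h := Finset.sum_multiset_count_of_subset p.parts (Finset.Icc 1 N) hsub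
  rw [p.parts_sum] at h
  conv_lhs => rw [h]
  push_cast
  simp [smul_eq_mul]

/-- **The cycle-index recursion.** The cycle-index sum `Z_N = ∑_{p ⊢ N} ∏_j (a_j/j)^{m_j}/m_j!`
satisfies `N · Z_N = ∑_{j=1}^{N} a_j Z_{N-j}` (for `canonicalZ`: `∑_j P_{Λ,N}(ξ₁ = j) = 1`).
[cite: Suto2002, §1 (4)–(5) and §2.1 (7), (10)] -/
theorem partitionSum_rec (a : ℕ → ℝ) (N : ℕ) :
    (N : ℝ) * ∑ p : Nat.Partition N,
        ∏ j ∈ p.parts.toFinset, (a j / j) ^ p.parts.count j / (p.parts.count j).factorial =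
      ∑ j ∈ Finset.Icc 1 N, a j * ∑ p : Nat.Partition (N - j),
        ∏ i ∈ p.parts.toFinset, (a i / i) ^ p.parts.count i / (p.parts.count i).factorial := by
  classical
  set w : Multiset ℕ → ℝ := fun s =>
    ∏ i ∈ s.toFinset, (a i / i) ^ s.count i / (s.count i).factorial with hw
  change (N : ℝ) * ∑ p : Nat.Partition N, w p.parts =
    ∑ j ∈ Finset.Icc 1 N, a j * ∑ p : Nat.Partition (N - j), w p.parts
  calc (N : ℝ) * ∑ p : Nat.Partition N, w p.parts
      = ∑ p : Nat.Partition N, ∑ j ∈ Finset.Icc 1 N,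
          ((p.parts.count j : ℕ) * j : ℝ) * w p.parts := by
        rw [Finset.mul_sum]
        refine Finset.sum_congr rfl fun p _ => ?_
        rw [← Finset.sum_mul, ← natCast_eq_sum_count_mul N p]
    _ = ∑ j ∈ Finset.Icc 1 N, ∑ p : Nat.Partition N,
          ((p.parts.count j : ℕ) * j : ℝ) * w p.parts := Finset.sum_comm
    _ = ∑ j ∈ Finset.Icc 1 N, a j * ∑ q : Nat.Partition (N - j), w q.parts := by
        refine Finset.sum_congr rfl fun j hj => ?_
        obtain ⟨hj1, hjN⟩ := Finset.mem_Icc.mp hj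
        set g : Nat.Partition N → ℝ := fun p =>
          ((p.parts.count j : ℕ) * j : ℝ) * w p.parts with hg
        have h1 : ∑ p : Nat.Partition N, g p =
            ∑ p ∈ Finset.univ.filter (fun p : Nat.Partition N => j ∈ p.parts), g p := by
          rw [Finset.sum_filter]
          refine Finset.sum_congr rfl fun p _ => ?_
          split_ifs with h
          · rfl
          · simp [hg, Multiset.count_eq_zero.mpr h]
        have h2 : ∑ p ∈ Finset.univ.filter (fun p : Nat.Partition N => j ∈ p.parts), g p =
            ∑ p : {p : Nat.Partition N // j ∈ p.parts}, g p.1 :=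
          Finset.sum_subtype _ (by simp) g
        change ∑ p : Nat.Partition N, g p = _
        rw [h1, h2, Finset.mul_sum, ← (Nat.Partition.partitionWithPartEquiv hj1 hjN).symm.sum_comp]
        refine Finset.sum_congr rfl fun q _ => ?_
        simp only [hg, hw]
        rw [Nat.Partition.partitionWithPartEquiv_symm_apply_parts, Multiset.count_cons_self]
        have := cycleWeight_cons a q.parts (j := j) (by omega)
        rw [← this]
        ring

/-- The recursion `Z_0 = 1`, `N Z_N = ∑_{j=1}^{N} a_j Z_{N-j}` has a solution (the cycle-index
sum). [folklore] -/
theorem exists_cycleSol (a : ℕ → ℝ) :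
    ∃ Z : ℕ → ℝ, Z 0 = 1 ∧ ∀ n : ℕ, (n : ℝ) * Z n = ∑ j ∈ Finset.Icc 1 n, a j * Z (n - j) :=
  ⟨fun N => ∑ p : Nat.Partition N,
      ∏ j ∈ p.parts.toFinset, (a j / j) ^ p.parts.count j / (p.parts.count j).factorial,
    by simp, fun n => partitionSum_rec a n⟩

/-! ### Uniqueness, geometric solutions, convolution, positivity -/

/-- `∑_{j=1}^{n} a_j Z_{n-j}` as a sum over the antidiagonal (weights extended by `a_0 = 0`).
[folklore] -/
theorem sum_Icc_eq_sum_antidiagonal (a Z : ℕ → ℝ) (n : ℕ) :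
    ∑ j ∈ Finset.Icc 1 n, a j * Z (n - j) =
      ∑ ij ∈ antidiagonal n, (if ij.1 = 0 then 0 else a ij.1) * Z ij.2 := by
  rw [Finset.Nat.sum_antidiagonal_eq_sum_range_succ (fun i j => (if i = 0 then 0 else a i) * Z j),
    Finset.sum_range_succ']
  simp only [Nat.succ_ne_zero, ↓reduceIte, zero_mul, add_zero]
  have : Finset.Icc 1 n = Finset.Ico 1 (n + 1) := rfl
  rw [this, Finset.sum_Ico_eq_sum_range]
  refine Finset.sum_congr (by simp) fun k _ => ?_
  rw [add_comm 1 k]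

/-- Solutions of the recursion are unique. [folklore] -/
theorem cycleSol_unique {a : ℕ → ℝ} {Z W : ℕ → ℝ} (hZ0 : Z 0 = 1)
    (hZ : ∀ n : ℕ, (n : ℝ) * Z n = ∑ j ∈ Finset.Icc 1 n, a j * Z (n - j)) (hW0 : W 0 = 1)
    (hW : ∀ n : ℕ, (n : ℝ) * W n = ∑ j ∈ Finset.Icc 1 n, a j * W (n - j)) : Z = W := by
  funext n
  induction n using Nat.strong_induction_on with
  | _ n ih =>
    rcases n with _ | n
    · rw [hZ0, hW0]
    · have h1 := hZ (n + 1)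
      have h2 := hW (n + 1)
      have hs : ∑ j ∈ Finset.Icc 1 (n + 1), a j * Z (n + 1 - j) =
          ∑ j ∈ Finset.Icc 1 (n + 1), a j * W (n + 1 - j) := by
        refine Finset.sum_congr rfl fun j hj => ?_
        rw [ih (n + 1 - j) (by have := (Finset.mem_Icc.mp hj).1; omega)]
      rw [hs, ← h2] at h1
      have hn : ((n + 1 : ℕ) : ℝ) ≠ 0 := by positivity
      exact mul_left_cancel₀ hn h1

/-- Geometric weights `a_j = c^j` have the geometric solution `Z_n = c^n`. [folklore] -/
theorem cycleSol_geom (c : ℝ) (n : ℕ) :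
    (n : ℝ) * c ^ n = ∑ j ∈ Finset.Icc 1 n, c ^ j * c ^ (n - j) := by
  have : ∀ j ∈ Finset.Icc 1 n, c ^ j * c ^ (n - j) = c ^ n := by
    intro j hj
    rw [← pow_add, Nat.add_sub_cancel' (Finset.mem_Icc.mp hj).2]
  rw [Finset.sum_congr rfl this, Finset.sum_const, Nat.card_Icc, nsmul_eq_mul]
  simp

section PowerSeries

open PowerSeries

/-- The recursion as an identity of formal power series: `X · F' = F · ∑_{k ≥ 1} a_k X^k`.
[folklore] -/
theorem cycleSol_iff_powerSeries (a : ℕ → ℝ) (Z : ℕ → ℝ) :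
    (∀ n : ℕ, (n : ℝ) * Z n = ∑ j ∈ Finset.Icc 1 n, a j * Z (n - j)) ↔
      PowerSeries.X * PowerSeries.derivative ℝ (PowerSeries.mk Z) =
        PowerSeries.mk (fun k => if k = 0 then 0 else a k) * PowerSeries.mk Z := by
  rw [PowerSeries.ext_iff]
  have key : ∀ n, (coeff n) (X * derivative ℝ (mk Z)) = (n : ℝ) * Z n := by
    intro n
    rcases n with _ | n
    · simp [PowerSeries.coeff_zero_X_mul]
    · rw [PowerSeries.coeff_succ_X_mul, PowerSeries.coeff_derivative, coeff_mk]
      push_cast; ring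
  have key2 : ∀ n, (coeff n) (mk (fun k => if k = 0 then 0 else a k) * mk Z) =
      ∑ j ∈ Finset.Icc 1 n, a j * Z (n - j) := by
    intro n
    rw [PowerSeries.coeff_mul, sum_Icc_eq_sum_antidiagonal]
    simp only [coeff_mk]
  simp only [key, key2]

/-- **Convolution (exponential formula).** Solutions for weights `a` and `b` multiply to a
solution for `a + b`: `X d/dX` is a derivation. [folklore] -/
theorem cycleSol_conv {a b : ℕ → ℝ} {Z W : ℕ → ℝ} (hZ0 : Z 0 = 1)
    (hZ : ∀ n : ℕ, (n : ℝ) * Z n = ∑ j ∈ Finset.Icc 1 n, a j * Z (n - j)) (hW0 : W 0 = 1)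
    (hW : ∀ n : ℕ, (n : ℝ) * W n = ∑ j ∈ Finset.Icc 1 n, b j * W (n - j)) :
    (∑ ij ∈ antidiagonal 0, Z ij.1 * W ij.2 = 1) ∧
      ∀ n : ℕ, (n : ℝ) * ∑ ij ∈ antidiagonal n, Z ij.1 * W ij.2 =
        ∑ j ∈ Finset.Icc 1 n, (a j + b j) * ∑ ik ∈ antidiagonal (n - j), Z ik.1 * W ik.2 := by
  refine ⟨by simp [hZ0, hW0], ?_⟩
  rw [cycleSol_iff_powerSeries (fun j => a j + b j)]
  have hmul : PowerSeries.mk (fun n => ∑ ij ∈ antidiagonal n, Z ij.1 * W ij.2) =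
      PowerSeries.mk Z * PowerSeries.mk W := by
    ext n; rw [PowerSeries.coeff_mul]; simp
  have hwt : PowerSeries.mk (fun k => if k = 0 then 0 else a k + b k) =
      PowerSeries.mk (fun k => if k = 0 then 0 else a k) +
        PowerSeries.mk (fun k => if k = 0 then 0 else b k) := by
    ext n; by_cases hn : n = 0 <;> simp [hn]
  have h1 := (cycleSol_iff_powerSeries a Z).mp hZ
  have h2 := (cycleSol_iff_powerSeries b W).mp hW
  rw [hmul, hwt, Derivation.leibniz, smul_eq_mul, smul_eq_mul, mul_add, ← mul_assoc, ← mul_assoc,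
    mul_comm X (mk Z), mul_assoc, h2, mul_comm X (mk W), mul_assoc, h1]
  ring

end PowerSeries

/-- Nonnegative weights give a nonnegative solution. [folklore] -/
theorem cycleSol_nonneg {a : ℕ → ℝ} {Z : ℕ → ℝ} (hZ0 : Z 0 = 1)
    (hZ : ∀ n : ℕ, (n : ℝ) * Z n = ∑ j ∈ Finset.Icc 1 n, a j * Z (n - j))
    (ha : ∀ j, 1 ≤ j → 0 ≤ a j) : ∀ n, 0 ≤ Z n := by
  intro n
  induction n using Nat.strong_induction_on with
  | _ n ih =>
    rcases n with _ | n
    · rw [hZ0]; exact zero_le_one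
    · have h := hZ (n + 1)
      have hs : 0 ≤ ∑ j ∈ Finset.Icc 1 (n + 1), a j * Z (n + 1 - j) :=
        Finset.sum_nonneg fun j hj => by
          have hj' := Finset.mem_Icc.mp hj
          exact mul_nonneg (ha j hj'.1) (ih _ (by omega))
      rw [← h] at hs
      have hn : (0 : ℝ) < (n + 1 : ℕ) := by positivity
      exact nonneg_of_mul_nonneg_right hs hn

/-- Nonnegative weights with `a_1 > 0` give a positive solution. [folklore] -/
theorem cycleSol_pos {a : ℕ → ℝ} {Z : ℕ → ℝ} (hZ0 : Z 0 = 1)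
    (hZ : ∀ n : ℕ, (n : ℝ) * Z n = ∑ j ∈ Finset.Icc 1 n, a j * Z (n - j))
    (ha : ∀ j, 1 ≤ j → 0 ≤ a j) (ha1 : 0 < a 1) : ∀ n, 0 < Z n := by
  intro n
  induction n with
  | zero => rw [hZ0]; exact zero_lt_one
  | succ n ih =>
    have h := hZ (n + 1)
    have hs : a 1 * Z n ≤ ∑ j ∈ Finset.Icc 1 (n + 1), a j * Z (n + 1 - j) := by
      have hmem : 1 ∈ Finset.Icc 1 (n + 1) := Finset.mem_Icc.mpr ⟨le_rfl, by omega⟩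
      rw [← Finset.add_sum_erase _ _ hmem, Nat.add_sub_cancel]
      have : 0 ≤ ∑ j ∈ (Finset.Icc 1 (n + 1)).erase 1, a j * Z (n + 1 - j) :=
        Finset.sum_nonneg fun j hj => by
          have hj' := Finset.mem_Icc.mp (Finset.mem_of_mem_erase hj)
          exact mul_nonneg (ha j hj'.1) (cycleSol_nonneg hZ0 hZ ha _)
      linarith
    have hpos : 0 < a 1 * Z n := mul_pos ha1 ih
    rw [← h] at hs
    have hn : (0 : ℝ) < (n + 1 : ℕ) := by positivity
    rcases mul_pos_iff.mp (hpos.trans_le hs) with ⟨_, h2⟩ | ⟨h1, _⟩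
    · exact h2
    · linarith

/-- The recursion only sees the weights `a_j`, `j ≥ 1`. [folklore] -/
theorem cycleSol_congr {a b : ℕ → ℝ} {Z : ℕ → ℝ}
    (hZ : ∀ n : ℕ, (n : ℝ) * Z n = ∑ j ∈ Finset.Icc 1 n, a j * Z (n - j))
    (h : ∀ j, 1 ≤ j → a j = b j) (n : ℕ) :
    (n : ℝ) * Z n = ∑ j ∈ Finset.Icc 1 n, b j * Z (n - j) := by
  rw [hZ n]
  exact Finset.sum_congr rfl fun j hj => by rw [h j (Finset.mem_Icc.mp hj).1]

/-! ### Log-concavity -/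

/-- Convolution with a geometric sequence: `V_{n+1} = c V_n + Z_{n+1}`. [folklore] -/
theorem conv_geom_succ (Z : ℕ → ℝ) (c : ℝ) (n : ℕ) :
    ∑ ij ∈ antidiagonal (n + 1), Z ij.1 * c ^ ij.2 =
      c * ∑ ij ∈ antidiagonal n, Z ij.1 * c ^ ij.2 + Z (n + 1) := by
  rw [Finset.Nat.sum_antidiagonal_succ']
  simp only [pow_zero, mul_one, pow_succ]
  rw [add_comm, Finset.mul_sum]
  congr 1
  exact Finset.sum_congr rfl fun ij _ => by ring

/-- **Log-concavity survives convolution with a geometric sequence.** If `u > 0` is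
log-concave, `c ≥ 0`, `v_0 = u_0` and `v_{n+1} = c v_n + u_{n+1}`, then `v > 0` is log-concave.
[folklore] -/
theorem logConcave_of_conv_geom {u v : ℕ → ℝ} {c : ℝ} (hc : 0 ≤ c) (hu : ∀ n, 0 < u n)
    (hlc : ∀ n, u n * u (n + 2) ≤ u (n + 1) ^ 2) (hv0 : v 0 = u 0)
    (hv : ∀ n, v (n + 1) = c * v n + u (n + 1)) :
    (∀ n, 0 < v n) ∧ ∀ n, v n * v (n + 2) ≤ v (n + 1) ^ 2 := by
  have hvpos : ∀ n, 0 < v n := by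
    intro n
    induction n with
    | zero => rw [hv0]; exact hu 0
    | succ n ih => rw [hv]; exact add_pos_of_nonneg_of_pos (mul_nonneg hc ih.le) (hu _)
  have hv' : ∀ n, v (n + 2) = c * v (n + 1) + u (n + 2) := fun n => hv (n + 1)
  have hlc' : ∀ n, u (n + 1) * u (n + 3) ≤ u (n + 2) ^ 2 := fun n => hlc (n + 1)
  -- Claim: `v_n u_{n+2} ≤ v_{n+1} u_{n+1}`
  have hA : ∀ n, v n * u (n + 2) ≤ v (n + 1) * u (n + 1) := by
    intro n
    induction n with
    | zero =>
      rw [hv, hv0]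
      have : 0 ≤ c * u 0 * u 1 := mul_nonneg (mul_nonneg hc (hu 0).le) (hu 1).le
      nlinarith [hlc 0, this]
    | succ n ih =>
      have h1 : v n * u (n + 2) * u (n + 3) ≤ v (n + 1) * u (n + 1) * u (n + 3) :=
        mul_le_mul_of_nonneg_right ih (hu _).le
      have h2 : v (n + 1) * u (n + 1) * u (n + 3) ≤ v (n + 1) * u (n + 2) ^ 2 := by
        have := hlc' n
        nlinarith [hvpos (n + 1)]
      have h3 : v n * u (n + 3) ≤ v (n + 1) * u (n + 2) := by
        have h4 : (v n * u (n + 3)) * u (n + 2) ≤ (v (n + 1) * u (n + 2)) * u (n + 2) := by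
          nlinarith [h1, h2]
        exact le_of_mul_le_mul_right h4 (hu _)
      have e : v (n + 1) * u (n + 3) = c * (v n * u (n + 3)) + u (n + 1) * u (n + 3) := by
        rw [hv n]; ring
      show v (n + 1) * u (n + 3) ≤ v (n + 2) * u (n + 2)
      rw [hv' n]
      nlinarith [e, mul_le_mul_of_nonneg_left h3 hc, hlc' n]
  refine ⟨hvpos, fun n => ?_⟩
  have e2 : v (n + 1) ^ 2 = c * (v n * v (n + 1)) + v (n + 1) * u (n + 1) := by
    linear_combination v (n + 1) * hv n
  rw [hv' n]
  nlinarith [hA n, hvpos n, hvpos (n + 1), e2]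

/-- **Log-concavity for finite positive power sums.** If `a_j = ∑_{i ∈ S} x_i^j` with all
`x_i > 0` and `S` nonempty, every solution `Z` of the recursion (a complete homogeneous symmetric
polynomial in the `x_i`) is positive and log-concave: `Z_N Z_{N+2} ≤ Z_{N+1}²`. [folklore] -/
theorem cycleSol_logConcave_finset {ι : Type*} (x : ι → ℝ) {S : Finset ι}
    (hS : S.Nonempty) (hx : ∀ i ∈ S, 0 < x i) (Z : ℕ → ℝ) (hZ0 : Z 0 = 1)
    (hZ : ∀ n : ℕ, (n : ℝ) * Z n = ∑ j ∈ Finset.Icc 1 n, (∑ i ∈ S, x i ^ j) * Z (n - j)) :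
    (∀ n, 0 < Z n) ∧ ∀ n, Z n * Z (n + 2) ≤ Z (n + 1) ^ 2 := by
  induction hS using Finset.Nonempty.cons_induction generalizing Z with
  | singleton i =>
    have hgeom : Z = fun n => x i ^ n :=
      cycleSol_unique hZ0 hZ (pow_zero _) fun n => by
        rw [cycleSol_geom (x i) n]
        exact Finset.sum_congr rfl fun j _ => by simp
    have hxi : 0 < x i := hx i (Finset.mem_singleton_self i)
    refine ⟨fun n => ?_, fun n => ?_⟩
    · rw [hgeom]; exact pow_pos hxi n
    · rw [hgeom]; simp only; rw [← pow_add, ← pow_mul]; ring_nf; rfl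
  | cons i S hi hS ih =>
    have hxS : ∀ k ∈ S, 0 < x k := fun k hk => hx k (Finset.mem_cons_of_mem hk)
    obtain ⟨u, hu0, hu⟩ := exists_cycleSol (fun j => ∑ k ∈ S, x k ^ j)
    obtain ⟨ihpos, ihlc⟩ := ih hxS u hu0 hu
    have hxi : 0 < x i := hx i (Finset.mem_cons_self i S)
    -- `Z` is the convolution of `u` with the geometric sequence of ratio `x i`
    obtain ⟨hc0, hc⟩ := cycleSol_conv hu0 hu (pow_zero (x i)) (cycleSol_geom (x i))
    have hconv : Z = fun n => ∑ ij ∈ antidiagonal n, u ij.1 * x i ^ ij.2 := by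
      refine cycleSol_unique hZ0 hZ hc0 fun n => ?_
      rw [hc n]
      refine Finset.sum_congr rfl fun j _ => ?_
      rw [Finset.sum_cons, add_comm]
    have hv0 : Z 0 = u 0 := by rw [hconv]; simp
    have hvs : ∀ n, Z (n + 1) = x i * Z n + u (n + 1) := by
      intro n; rw [hconv]; exact conv_geom_succ u (x i) n
    exact logConcave_of_conv_geom hxi.le ihpos ihlc hv0 hvs

/-- One extra mode of weight `1` (`a_j = a'_j + 1`) turns a solution `Z'` into its partial sums:
`Z_{n+1} - Z_n = Z'_{n+1}`. [folklore] -/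
theorem cycleSol_succ_sub_eq {a a' : ℕ → ℝ} {Z Z' : ℕ → ℝ} (hZ0 : Z 0 = 1)
    (hZ : ∀ n : ℕ, (n : ℝ) * Z n = ∑ j ∈ Finset.Icc 1 n, a j * Z (n - j)) (hZ'0 : Z' 0 = 1)
    (hZ' : ∀ n : ℕ, (n : ℝ) * Z' n = ∑ j ∈ Finset.Icc 1 n, a' j * Z' (n - j))
    (h : ∀ j, 1 ≤ j → a j = a' j + 1) (n : ℕ) :
    Z (n + 1) - Z n = Z' (n + 1) := by
  obtain ⟨hc0, hc⟩ := cycleSol_conv hZ'0 hZ' (pow_zero (1 : ℝ)) (cycleSol_geom (1 : ℝ))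
  have hW : Z = fun n => ∑ ij ∈ antidiagonal n, Z' ij.1 * (1 : ℝ) ^ ij.2 := by
    refine cycleSol_unique hZ0 hZ hc0 fun n => ?_
    rw [hc n]
    exact Finset.sum_congr rfl fun j hj => by rw [h j (Finset.mem_Icc.mp hj).1, one_pow]
  rw [hW]
  simp only
  rw [conv_geom_succ]
  ring

/-- With one extra mode of weight `1` over nonnegative weights, the solution is nondecreasing
(`Q_{Λ,N-1} ≤ Q_{Λ,N}` for the free Bose gas with its zero mode). [folklore] -/
theorem cycleSol_monotone {a a' : ℕ → ℝ} {Z Z' : ℕ → ℝ} (hZ0 : Z 0 = 1)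
    (hZ : ∀ n : ℕ, (n : ℝ) * Z n = ∑ j ∈ Finset.Icc 1 n, a j * Z (n - j)) (hZ'0 : Z' 0 = 1)
    (hZ' : ∀ n : ℕ, (n : ℝ) * Z' n = ∑ j ∈ Finset.Icc 1 n, a' j * Z' (n - j))
    (h : ∀ j, 1 ≤ j → a j = a' j + 1) (ha' : ∀ j, 1 ≤ j → 0 ≤ a' j) : Monotone Z :=
  monotone_nat_of_le_succ fun n => by
    have := cycleSol_succ_sub_eq hZ0 hZ hZ'0 hZ' h n
    linarith [cycleSol_nonneg hZ'0 hZ' ha' (n + 1)]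

/-! ### Continuity in the weights -/

/-- Solutions of the recursion depend continuously on the weights. [folklore] -/
theorem tendsto_cycleSol {α : Type*} {l : Filter α} {A : α → ℕ → ℝ} {a : ℕ → ℝ}
    {ZA : α → ℕ → ℝ} {Z : ℕ → ℝ} (hZA0 : ∀ k, ZA k 0 = 1)
    (hZA : ∀ k (n : ℕ), (n : ℝ) * ZA k n = ∑ j ∈ Finset.Icc 1 n, A k j * ZA k (n - j))
    (hZ0 : Z 0 = 1) (hZ : ∀ n : ℕ, (n : ℝ) * Z n = ∑ j ∈ Finset.Icc 1 n, a j * Z (n - j))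
    (h : ∀ j, Tendsto (fun k => A k j) l (𝓝 (a j))) (n : ℕ) :
    Tendsto (fun k => ZA k n) l (𝓝 (Z n)) := by
  have eA : ∀ k, ZA k = fun N => ∑ p : Nat.Partition N,
      ∏ j ∈ p.parts.toFinset, (A k j / j) ^ p.parts.count j / (p.parts.count j).factorial :=
    fun k => cycleSol_unique (hZA0 k) (hZA k) (by simp) (partitionSum_rec (A k))
  have eZ : Z = fun N => ∑ p : Nat.Partition N,
      ∏ j ∈ p.parts.toFinset, (a j / j) ^ p.parts.count j / (p.parts.count j).factorial :=
    cycleSol_unique hZ0 hZ (by simp) (partitionSum_rec a)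
  simp only [eA, eZ]
  refine tendsto_finsetSum _ fun p _ => tendsto_finsetProd _ fun j _ => ?_
  exact (((h j).div_const _).pow _).div_const _

/-- Log-concavity passes to limits of the weights. [folklore] -/
theorem cycleSol_logConcave_of_tendsto {α : Type*} {l : Filter α} [l.NeBot] {A : α → ℕ → ℝ}
    {a : ℕ → ℝ} {ZA : α → ℕ → ℝ} {Z : ℕ → ℝ} (hZA0 : ∀ k, ZA k 0 = 1)
    (hZA : ∀ k (n : ℕ), (n : ℝ) * ZA k n = ∑ j ∈ Finset.Icc 1 n, A k j * ZA k (n - j))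
    (hZ0 : Z 0 = 1) (hZ : ∀ n : ℕ, (n : ℝ) * Z n = ∑ j ∈ Finset.Icc 1 n, a j * Z (n - j))
    (h : ∀ j, Tendsto (fun k => A k j) l (𝓝 (a j)))
    (hlc : ∀ k n, ZA k n * ZA k (n + 2) ≤ ZA k (n + 1) ^ 2) (n : ℕ) :
    Z n * Z (n + 2) ≤ Z (n + 1) ^ 2 :=
  le_of_tendsto_of_tendsto ((tendsto_cycleSol hZA0 hZA hZ0 hZ h n).mul
    (tendsto_cycleSol hZA0 hZA hZ0 hZ h (n + 2))) ((tendsto_cycleSol hZA0 hZA hZ0 hZ h (n + 1)).pow 2)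
    (Eventually.of_forall fun k => hlc k n)

/-! ### Ratios of consecutive terms -/

/-- For a positive log-concave sequence the ratio `Z_n / Z_{n+1}` is nondecreasing
(for `canonicalZ`: the canonical activity `Q_{N-1}/Q_N` increases with `N`). [folklore] -/
theorem ratio_monotone_of_logConcave {Z : ℕ → ℝ} (hpos : ∀ n, 0 < Z n)
    (hlc : ∀ n, Z n * Z (n + 2) ≤ Z (n + 1) ^ 2) : Monotone fun n => Z n / Z (n + 1) :=
  monotone_nat_of_le_succ fun n => by
    show Z n / Z (n + 1) ≤ Z (n + 1) / Z (n + 1 + 1)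
    rw [div_le_div_iff₀ (hpos _) (hpos _)]
    nlinarith [hlc n]

/-- Telescoping: `Z_m / Z_{m+j} = ∏_{i<j} Z_{m+i}/Z_{m+i+1}`. [folklore] -/
theorem div_eq_prod_ratio {Z : ℕ → ℝ} (hpos : ∀ n, 0 < Z n) (m j : ℕ) :
    Z m / Z (m + j) = ∏ i ∈ Finset.range j, Z (m + i) / Z (m + i + 1) := by
  induction j with
  | zero => simp [div_self (hpos m).ne']
  | succ j ih =>
    rw [Finset.prod_range_succ, ← ih, ← add_assoc]
    field_simp [(hpos (m + j)).ne', (hpos (m + j + 1)).ne']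

/-- Lower bound `(Z_m/Z_{m+1})^j ≤ Z_m / Z_{m+j}` for positive log-concave `Z`. [folklore] -/
theorem ratio_pow_le_div {Z : ℕ → ℝ} (hpos : ∀ n, 0 < Z n)
    (hlc : ∀ n, Z n * Z (n + 2) ≤ Z (n + 1) ^ 2) (m j : ℕ) :
    (Z m / Z (m + 1)) ^ j ≤ Z m / Z (m + j) := by
  rw [div_eq_prod_ratio hpos m j]
  calc (Z m / Z (m + 1)) ^ j = ∏ _i ∈ Finset.range j, Z m / Z (m + 1) := by
        rw [Finset.prod_const, Finset.card_range]
    _ ≤ ∏ i ∈ Finset.range j, Z (m + i) / Z (m + i + 1) :=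
        Finset.prod_le_prod (fun i _ => (div_pos (hpos _) (hpos _)).le) fun i _ =>
          ratio_monotone_of_logConcave hpos hlc (Nat.le_add_right m i)

/-- Upper bound `Z_m / Z_{m+j+1} ≤ (Z_{m+j}/Z_{m+j+1})^{j+1}` for positive log-concave `Z`.
[folklore] -/
theorem div_le_ratio_pow {Z : ℕ → ℝ} (hpos : ∀ n, 0 < Z n)
    (hlc : ∀ n, Z n * Z (n + 2) ≤ Z (n + 1) ^ 2) (m j : ℕ) :
    Z m / Z (m + (j + 1)) ≤ (Z (m + j) / Z (m + j + 1)) ^ (j + 1) := by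
  rw [div_eq_prod_ratio hpos m (j + 1)]
  calc ∏ i ∈ Finset.range (j + 1), Z (m + i) / Z (m + i + 1)
      ≤ ∏ _i ∈ Finset.range (j + 1), Z (m + j) / Z (m + j + 1) :=
        Finset.prod_le_prod (fun i _ => (div_pos (hpos _) (hpos _)).le) fun i hi =>
          ratio_monotone_of_logConcave hpos hlc (by
            have := Finset.mem_range.mp hi; omega)
    _ = (Z (m + j) / Z (m + j + 1)) ^ (j + 1) := by rw [Finset.prod_const, Finset.card_range]

end Literature.Barriers.AtomisticToContinuum.BoseGas.IdealGas

end
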